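import Summits.BirchSwinnertonDyer.Rank1Residual.Additive.CensusX42ForallAnomalousWitness
import Summits.BirchSwinnertonDyer.Rank1Residual.Additive.RankOneUpperHalfUnitRows
import HarnessLib

/-!
# Rescaling the `p`-adic height datum, V: the `p = 3` witnesses against n1011-p16's two `∀ Dh`
# unit-row wrappers (cell `b2b-bsdres`, census cell `bsd-formula-census`, seat
# `b2b-bsdres-census-ctyper1` = conjecture-typer 1, gen 9; prequels `CensusX42ForallAnomalous.lean`,
# `CensusX42ForallAnomalousWitness.lean`)

HONEST FRAMING (cell `b2b-bsdres`, run/shared/lean/b2b/bsd-rank1-residual/, verbatim in every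
file): the goal of the cell is to DELETE the COMBINATION-SHAPED residual classes of the
Birch–Swinnerton-Dyer formula for ALL analytic-rank `≤ 1` elliptic curves over `ℚ` — "full BSD
formula for every rank `≤ 1` curve in class `C`" assembled STRICTLY from published theorems — so
that the rank-`≤ 1` remainder becomes exactly the CONSTRUCTION-SHAPED classes, which are TYPED
(missing-input `Prop`s), NOT attempted. This is not "finishing BSD". Census cell
(bsd-formula-census): research instrumentation; census output = EVIDENCE / conjecture items, never a
Literature fact; labels / RESIDUAL-MAP marks UNCHANGED (O7-ord OPEN; X3♯ / X4♯ CONSTRUCTION-SHAPED);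
nothing booked. Theorems only (no definition, no named fact); named facts enter as HYPOTHESES
(`hDel3`, `hK` / `hWu`, `hGZK`, `hmod`, `hmodD`).

## What (ERRATUM-grade, for n1011-p16 / the n1011 lead / referee 1)

n1011-p16's `RankOneUpperHalfUnitRows.lean` (row T-S10 family) carries, next to its POINTWISE
unit-row theorems, two `∀ Dh` wrappers at `p = 3` in which Delbourgo 2002 at `3` (`hDel3`, `hcm`)
supplies the (B)-datum and the typed input is packaged as
`hGZ : ∀ Dh, LeadingTermClauses W 3 Dh → SchneiderConjecture Dh ∧ BranchPAdicGrossZagierOddAt W 3 Dh`: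
`ClassX4Gord.bsdp_three_rankOne_of_katoHalf_of_delbourgo_of_forall_branchPAdicGrossZagierOdd_of_shaAn_unit`
and `ClassX3Gord.bsdp_three_rankOne_of_wuthrichHalf_of_delbourgo_of_forall_branchPAdicGrossZagierOdd_of_shaAn_unit`.
Below, with EXACTLY their binder lists plus `hanom : ¬ ReductionNonAnomalous W 3`, the hypothesis
`hGZ` is REFUTED (prequel §6 at `p = 3`; `e = 2` is automatic for type (G) at `3`,
`semistabilityIndex_eq_two_of_typeG_three`). So the two wrappers — and p16 GEN 4's (S10i) isogeny form
`ClassX3Gord.bsdp_three_rankOne_of_isIsogenous_of_wuthrichHalf_of_delbourgo_of_forall_branchPAdicGrossZagierOdd_of_shaAn_unit`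
(`RankOneUpperHalfUnitRowsIsogeny.lean`), which feeds the second one at the isogenous `E₀` — are TRUE
VACUOUSLY on the ANOMALOUS rows at `3` (`3 ∣ #Ẽ_{F,w}(𝔽₃)` over the (G)-fields, for `E` resp. `E₀`;
r3's (S10) matrix `cells/n1011/ROUTE-3.md` l.76: the anomalous Gord3 / X3 unit rows) — NOT coverage
there; on the NON-anomalous rows they stand (there the (B)-data are one unit class in norm and `hGZ`
is the pointwise input up to a unit).
STATEMENTS OF RECORD on the anomalous unit rows: the pointwise
`ClassX4Gord.bsdp_three_rankOne_of_katoHalf_of_branchPAdicGrossZagierOdd_of_shaAn_unit` /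
`ClassX3Gord.bsdp_three_rankOne_of_wuthrichHalf_of_branchPAdicGrossZagierOdd_of_shaAn_unit` (same file)
and this seat's pointwise window-grade nodes (`CensusX42ValUnitRows.lean`). No label / mark / count
of record changes; nothing booked.

References: D. Delbourgo, J. Number Theory 95 (2002) p. 39 (`ℓ_p(E)`), Thm. (A), (B) (p. 40)
[Delbourgo2002]; K. Kato, Astérisque 295 (2004) Thm. 17.4 (3) [Kato2004Asterisque]; C. Wuthrich,
Doc. Math. 19 (2014) Thm. 16, Lemma 20 [Wuthrich2014]; R. L. Miller, LMS J. Comput. Math. 14 (2011)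
Def. 1.1 [Miller2011LMS].
-/

set_option autoImplicit false

noncomputable section

open scoped Classical MatrixGroups ModularForm NumberField

open CongruenceSubgroup WeierstrassCurve NumberField Literature.NumberTheory.EllipticCurves
  Literature.NumberTheory.EllipticCurves.ModularForms
  Literature.NumberTheory.EllipticCurves.Rank1Residual
  Literature.NumberTheory.EllipticCurves.Rank1Residual.Typed
  Literature.NumberTheory.EllipticCurves.Delbourgo2002
  Literature.NumberTheory.GaloisRepresentations
  Literature.Barriers.BirchSwinnertonDyer
  IsDedekindDomain

namespace Summit.BirchSwinnertonDyer.Rank1Residual.Additive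

/-! ### §7 The `p = 3` forms against n1011-p16's two `∀ Dh` unit-row wrappers -/

/-- **p16's `ClassX4Gord.bsdp_three_rankOne_of_katoHalf_of_delbourgo_of_forall_branchPAdicGrossZagierOdd_of_shaAn_unit`
is VACUOUS on the ANOMALOUS rows at `3`:** with EXACTLY its binders (`hDel3`, `hK`, `hGZK`, `hmod`,
`hmodD`, `hX : ClassX4Gord W 3`, `hcm`, `hsurj`, `hr`, unit literal `hq`/`hv`) plus
`hanom : ¬ ReductionNonAnomalous W 3`, its packaging hypothesis `hGZ` is REFUTED (Delbourgo 2002 at `3`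
supplies the (B)-datum; `e = 2` is automatic for type (G) at `3`). Statement of record there: the
pointwise `ClassX4Gord.bsdp_three_rankOne_of_katoHalf_of_branchPAdicGrossZagierOdd_of_shaAn_unit`.
[cite: Delbourgo2002, Theorem (A), (B) (p. 40) and p. 39 (ℓ_p(E))] [cite: Kato2004Asterisque, Thm. 17.4 (3) (p. 273)] -/
theorem ClassX4Gord.not_forall_leadingTermClauses_imp_branchPAdicGrossZagierOdd_three_of_delbourgo_of_shaAn_unit_of_anomalous
    {W : WeierstrassCurve ℚ} [W.IsElliptic] [W.IsGloballyMinimal] [Fact (Nat.Prime 3)]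
    (hDel3 : Delbourgo2002.mainTheorem_three)
    (hK : Wuthrich2014.kato_halfEigenCharIdeal_dvd_cyclotomicPrime_of_surjective)
    (hGZK : rank_eq_analyticRank_of_analyticRank_le_one) (hmod : hasEntireLFunction_rat)
    (hmodD : nonempty_modularParametrizationData) (hX : ClassX4Gord W 3) (hcm : ¬ W.HasCM) (hsurj : Surj W 3)
    (hr : W.analyticRank = 1) {q : ℚ} (hq : shaAn W = (q : ℂ)) (hv : padicValRat 3 q = 0)
    (hanom : ¬ ReductionNonAnomalous W 3) :
    ¬ ∀ Dh : PAdicHeightData W 3, LeadingTermClauses W 3 Dh →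
        SchneiderConjecture Dh ∧ BranchPAdicGrossZagierOddAt W 3 Dh := by
  obtain ⟨-, Dh, hB⟩ := hX.delbourgo2002_three hDel3 hcm
  exact hX.not_forall_leadingTermClauses_imp_branchPAdicGrossZagierOdd_of_shaAn_unit_of_anomalous hK hGZK
    hmod hmodD (semistabilityIndex_eq_two_of_typeG_three W hX.typeGOrd.typeG hX.addv.2) (by norm_num) hsurj
    hr hanom ⟨Dh, hB⟩ hq hv

/-- **p16's `ClassX3Gord.bsdp_three_rankOne_of_wuthrichHalf_of_delbourgo_of_forall_branchPAdicGrossZagierOdd_of_shaAn_unit`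
is VACUOUS on the ANOMALOUS rows at `3`** (binders `hDel3`, `hWu`, `hGZK`, `hmod`, `hmodD`,
`hX : ClassX3Gord W 3`, `hcm`, `hr`, `hq`/`hv` + `hanom`). Statement of record there: the pointwise
`ClassX3Gord.bsdp_three_rankOne_of_wuthrichHalf_of_branchPAdicGrossZagierOdd_of_shaAn_unit`.
[cite: Delbourgo2002, Theorem (A), (B) (p. 40) and p. 39 (ℓ_p(E))] [cite: Wuthrich2014, Thm. 16 (p. 397)] -/
theorem ClassX3Gord.not_forall_leadingTermClauses_imp_branchPAdicGrossZagierOdd_three_of_delbourgo_of_shaAn_unit_of_anomalous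
    {W : WeierstrassCurve ℚ} [W.IsElliptic] [W.IsGloballyMinimal] [Fact (Nat.Prime 3)]
    (hDel3 : Delbourgo2002.mainTheorem_three)
    (hWu : Wuthrich2014.thm16_halfEigenCharIdeal_dvd_cyclotomicPrime)
    (hGZK : rank_eq_analyticRank_of_analyticRank_le_one) (hmod : hasEntireLFunction_rat)
    (hmodD : nonempty_modularParametrizationData) (hX : ClassX3Gord W 3) (hcm : ¬ W.HasCM)
    (hr : W.analyticRank = 1) {q : ℚ} (hq : shaAn W = (q : ℂ)) (hv : padicValRat 3 q = 0)
    (hanom : ¬ ReductionNonAnomalous W 3) :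
    ¬ ∀ Dh : PAdicHeightData W 3, LeadingTermClauses W 3 Dh →
        SchneiderConjecture Dh ∧ BranchPAdicGrossZagierOddAt W 3 Dh := by
  obtain ⟨-, Dh, hB⟩ := hX.delbourgo2002_three hDel3 hcm
  exact hX.not_forall_leadingTermClauses_imp_branchPAdicGrossZagierOdd_of_shaAn_unit_of_anomalous hWu hGZK
    hmod hmodD (semistabilityIndex_eq_two_of_typeG_three W hX.typeGOrd.typeG hX.addv) (by norm_num)
    hr hanom ⟨Dh, hB⟩ hq hv

end Summit.BirchSwinnertonDyer.Rank1Residual.Additive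

end
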